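import Literature.Probability.Percolation.HutchcroftVolumeTail
import HarnessLib

/-!
# `δ = 2`, upper half, from `γ ≤ 1`: `P_{p_c}(|C(0)| ≥ n) ≤ C n^{-1/2}` via Hutchcroft's Thm. 1.3

Topic `Literature/Probability/Percolation`, family `crit-perc`. The critical volume-tail bound
`P_{p_c}(|C(0)| ≥ n) ≍ n^{-1/2}` (`δ = 2` in the bounded-ratio sense, Heydenreich–van der Hofstad
2017, (1.2.10) and Thm. 4.1; Barsky–Aizenman 1991 under the triangle condition) has an upper
half that, as observed by Hutchcroft 2022, §1.1, follows at once from the upper half of `γ = 1`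
(`χ(p) ≤ B/(p_c - p)`, Aizenman–Newman 1984 under the triangle condition) and his relative-entropy
inequality Thm. 1.3: "Taking `β₁ = β_c - n^{-1/2}` and `β₂ = β_c` in this inequality shows that the
upper bound of (1.1) implies the upper bound of (1.2)". Since Thm. 1.3 is PROVED in this tree
(`Hutchcroft2022_thm13_holds`, `HutchcroftVolumeTail.lean`), this file PROVES:

* `real_clusterSizeGe_criticalProb_le_of_gamma` — granted the named fact
  `AizenmanNewman1984_gamma_eq_one` (only its upper bound is used), on `ℤ^d`, `d ≥ 2`, under the
  triangle condition there is `C` with `P_{p_c}(|C(0)| ≥ n) ≤ C/√n` for all `n ≥ 1`.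
  Quantitatively (in the retention parametrisation, `β = -2d log(1-p)`): for `0 < ε < ε₀`,
  `p₁ = p_c - ε`, Thm. 1.3 gives `P_{p_c}(|C| ≥ n) ≤ 2P_{p₁}(|C| ≥ n) + (4/β₁)(β_c-β₁)² χ(p₁)`,
  where `n P_{p₁}(|C| ≥ n) ≤ Σ_{k≤n} P_{p₁}(|C| ≥ k) ≤ χ(p₁) ≤ B/ε` and
  `(4/β₁)(β_c - β₁)² ≤ 256 d ε²/(p_c(1-p_c)²)`; the choice `ε = (ε₀/2)/√n` gives `C/√n`.

Nothing else (no new definitions, no new named facts). The lower half `P_{p_c}(|C| ≥ n) ≥ c/√n`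
(`δ ≥ 2`, valid in every dimension, Heydenreich–van der Hofstad 2017, Prop. 3.6 / Cor. 4.5 in the
generating-function sense) is not treated here.

## References

* T. Hutchcroft, *On the derivation of mean-field percolation critical exponents from the triangle
  condition*, J. Stat. Phys. 189 (2022) no. 6 (arXiv:2106.06400): Thm. 1.3 and §1.1, the sentence
  following Thm. 1.3.
* M. Heydenreich, R. van der Hofstad, *Progress in High-Dimensional Percolation and Random Graphs*,
  Springer 2017: (1.2.10) (`δ`), Thm. 4.1 (`β = γ = 1`, `δ = 2` in the bounded-ratio sense under the
  triangle condition [Aizenman–Newman 1984, Barsky–Aizenman 1991]).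
* D. J. Barsky, M. Aizenman, Ann. Probab. 19 (1991) 1520–1536.
-/

noncomputable section

namespace Literature.Probability.Percolation

open _root_.MeasureTheory _root_.Filter _root_.Topology
open Literature.Probability.LatticeModels
open scoped ENNReal

variable {d : ℕ}

/-- Markov's inequality for the cluster size in the form used here: since `{|C| ≥ k}` decreases in
`k`, `n · P_p(|C(x)| ≥ n) ≤ Σ_{k=1}^{n} P_p(|C(x)| ≥ k)` (`≤ E_p|C(x)|`). [folklore] -/
theorem mul_real_clusterSizeGe_le_sum {V : Type*} [Countable V] (G : SimpleGraph V) (x : V)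
    (p : unitInterval) (n : ℕ) :
    (n : ℝ) * (bondPercolation G p).real (clusterSizeGe x n) ≤
      ∑ k ∈ Finset.Icc 1 n, (bondPercolation G p).real (clusterSizeGe x k) := by
  calc (n : ℝ) * (bondPercolation G p).real (clusterSizeGe x n)
      = ∑ k ∈ Finset.Icc 1 n, (bondPercolation G p).real (clusterSizeGe x n) := by
        rw [Finset.sum_const, Nat.card_Icc, nsmul_eq_mul]
        congr 1
    _ ≤ ∑ k ∈ Finset.Icc 1 n, (bondPercolation G p).real (clusterSizeGe x k) :=
        Finset.sum_le_sum fun k hk =>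
          measureReal_mono (clusterSizeGe_antitone x (Finset.mem_Icc.1 hk).2)

/-- **`δ = 2`, upper half, from `γ ≤ 1` and Hutchcroft's Thm. 1.3** (Hutchcroft 2022, §1.1: "Taking
`β₁ = β_c - n^{-1/2}` and `β₂ = β_c` in this inequality shows that the upper bound of (1.1) implies
the upper bound of (1.2)", (1.2) being `P_{p_c}(|K| ≥ n) ≍ n^{-1/2}`): on `ℤ^d`, `d ≥ 2`, granted
Aizenman–Newman's `γ = 1` under the triangle condition (`AizenmanNewman1984_gamma_eq_one`; only
`χ(p) ≤ B/(p_c - p)` is used) and the triangle condition, there is `C` with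
`P_{p_c}(|C(0)| ≥ n) ≤ C/√n` for every `n ≥ 1` — the upper half of `δ = 2` in the bounded-ratio
sense (Heydenreich–van der Hofstad 2017, Thm. 4.1 with (1.2.10); Barsky–Aizenman 1991). Thm. 1.3
itself is `Hutchcroft2022_thm13_holds`.
[cite: Hutchcroft2022Triangle, §1.1 (Thm. 1.3 and the sentence following it)]
[cite: HeydenreichVanDerHofstad2017, Thm. 4.1 with (1.2.10)] -/
theorem real_clusterSizeGe_criticalProb_le_of_gamma (h₁ : AizenmanNewman1984_gamma_eq_one)
    (hd : 2 ≤ d) (hT : TriangleCondition d) :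
    ∃ C : ℝ, ∀ n : ℕ, 1 ≤ n →
      (bondPercolation (zdGraph d) (criticalProbI d)).real (clusterSizeGe (0 : Site d) n) ≤
        C / Real.sqrt n := by
  have hd1 : 1 ≤ d := by omega
  set pc : ℝ := criticalProb (zdGraph d) (0 : Site d) with hpc
  have hpc0 : 0 < pc := criticalProb_zd_pos d hd1
  have hpc1 : pc < 1 := criticalProb_zd_lt_one hd
  obtain ⟨A, B, δ₁, hA, hB, hδ₁, hχ⟩ := h₁ d hd hT
  have hdR : (1 : ℝ) ≤ d := by exact_mod_cast hd1
  -- the constant of the quadratic term and the admissible range of `ε`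
  set K : ℝ := 256 * d * B / (pc * (1 - pc) ^ 2) with hK
  have hK0 : 0 < K := by
    have : 0 < pc * (1 - pc) ^ 2 := mul_pos hpc0 (pow_pos (by linarith) 2)
    positivity
  set ε₀ : ℝ := min δ₁ (min (pc / 2) ((1 - pc) / 2)) with hε₀
  have hε₀0 : 0 < ε₀ := lt_min hδ₁ (lt_min (by linarith) (by linarith))
  have hε₀δ : ε₀ ≤ δ₁ := min_le_left _ _
  have hε₀pc : ε₀ ≤ pc / 2 := (min_le_right _ _).trans (min_le_left _ _)
  have hε₀1 : ε₀ ≤ (1 - pc) / 2 := (min_le_right _ _).trans (min_le_right _ _)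
  -- main claim: for `0 < ε < ε₀` and `n ≥ 1`, `P_{p_c}(|C| ≥ n) ≤ 2B/(εn) + K ε`
  have claim : ∀ ε : ℝ, 0 < ε → ε < ε₀ → ∀ n : ℕ, 1 ≤ n →
      (bondPercolation (zdGraph d) (criticalProbI d)).real (clusterSizeGe (0 : Site d) n) ≤
        2 * (B / (ε * n)) + K * ε := by
    intro ε hε hεε₀ n hn
    have hn0 : (0 : ℝ) < n := by exact_mod_cast hn
    -- the subcritical comparison point `p₁ = p_c - ε`, and `p = p_c`
    have hp1I : pc - ε ∈ unitInterval := ⟨by linarith, by linarith⟩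
    set p₁ : unitInterval := ⟨pc - ε, hp1I⟩ with hp₁
    set p : unitInterval := criticalProbI d with hp
    have hpcoe : (p : ℝ) = pc := rfl
    have hp₁c : (p₁ : ℝ) < criticalProb (zdGraph d) 0 := by show pc - ε < pc; linarith
    have hp₁0 : 0 < (p₁ : ℝ) := by show 0 < pc - ε; linarith
    have hp2lt1 : (p : ℝ) < 1 := by rw [hpcoe]; exact hpc1
    have hp12 : (p₁ : ℝ) ≤ p := by rw [hpcoe]; show pc - ε ≤ pc; linarith
    -- Hutchcroft parameters
    set β₁ : ℝ := -(2 * d) * Real.log (1 - p₁) with hβ₁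
    set β₂ : ℝ := -(2 * d) * Real.log (1 - p) with hβ₂
    obtain ⟨hβ₁low, hβ₁₂, hβdiff⟩ := hutchcroft_beta_estimates d hp12 hp2lt1
    have hβ₁pos : 0 < β₁ := lt_of_lt_of_le (by positivity) hβ₁low
    have hP₁ : hutchcroftParam d β₁ = p₁ := hutchcroftParam_neg_log hd1 p₁ (by linarith)
    have hP₂ : hutchcroftParam d β₂ = p := hutchcroftParam_neg_log hd1 p hp2lt1
    -- susceptibility bound at `p₁`
    have hχ₁ : expClusterSize (zdGraph d) 0 p₁ ≤ ENNReal.ofReal (B / ε) := by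
      have h := (hχ p₁ (by show pc - δ₁ < pc - ε; linarith) hp₁c).2
      have : criticalProb (zdGraph d) 0 - (p₁ : ℝ) = ε := by show pc - (pc - ε) = ε; ring
      rwa [this] at h
    have hS : ∑ k ∈ Finset.Icc 1 n,
        (bondPercolation (zdGraph d) p₁).real (clusterSizeGe (0 : Site d) k) ≤ B / ε := by
      have h := (ofReal_sum_real_clusterSizeGe_le (zdGraph d) (0 : Site d) p₁ n).trans hχ₁
      exact (ENNReal.ofReal_le_ofReal_iff (by positivity)).1 h
    -- Markov at `p₁`: `P_{p₁}(|C| ≥ n) ≤ B/(εn)`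
    have hM : (bondPercolation (zdGraph d) p₁).real (clusterSizeGe (0 : Site d) n) ≤ B / (ε * n) := by
      have h := (mul_real_clusterSizeGe_le_sum (zdGraph d) (0 : Site d) p₁ n).trans hS
      rw [le_div_iff₀ (by positivity)]
      calc (bondPercolation (zdGraph d) p₁).real (clusterSizeGe (0 : Site d) n) * (ε * n)
          = ((n : ℝ) * (bondPercolation (zdGraph d) p₁).real (clusterSizeGe (0 : Site d) n)) * ε := by
            ring
        _ ≤ B / ε * ε := mul_le_mul_of_nonneg_right h hε.le
        _ = B := div_mul_cancel₀ B hε.ne'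
    -- Hutchcroft's inequality at `n`
    have hH : (bondPercolation (zdGraph d) p).real (clusterSizeGe (0 : Site d) n) ≤
        2 * (bondPercolation (zdGraph d) p₁).real (clusterSizeGe (0 : Site d) n) +
          4 / β₁ * (β₂ - β₁) ^ 2 * (B / ε) := by
      have h := Hutchcroft2022_thm13_holds d hd1 β₁ β₂ hβ₁pos hβ₁₂ n
      rw [hP₁, hP₂] at h
      refine h.trans (add_le_add le_rfl ?_)
      exact mul_le_mul_of_nonneg_left hS (by positivity)
    -- estimate the constant of the quadratic term
    have hβ₁inv : 4 / β₁ ≤ 4 / (d * pc) := by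
      have : d * pc ≤ β₁ := by
        have : 2 * d * (p₁ : ℝ) ≥ d * pc := by
          show 2 * d * (pc - ε) ≥ d * pc
          nlinarith
        linarith
      exact div_le_div_of_nonneg_left (by norm_num) (by positivity) this
    have hdiff : β₂ - β₁ ≤ 8 * d * ε / (1 - pc) := by
      have h1 : (p : ℝ) - p₁ ≤ 2 * ε := by rw [hpcoe]; show pc - (pc - ε) ≤ 2 * ε; linarith
      have h2 : (1 - pc) / 2 ≤ 1 - (p : ℝ) := by rw [hpcoe]; linarith
      calc β₂ - β₁ ≤ 2 * d * (((p : ℝ) - p₁) / (1 - p)) := hβdiff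
        _ ≤ 2 * d * ((2 * ε) / ((1 - pc) / 2)) := by gcongr
        _ = 8 * d * ε / (1 - pc) := by field_simp; ring
    have hdiff0 : 0 ≤ β₂ - β₁ := by linarith
    have hquad : 4 / β₁ * (β₂ - β₁) ^ 2 * (B / ε) ≤ K * ε :=
      calc 4 / β₁ * (β₂ - β₁) ^ 2 * (B / ε) ≤ 4 / (d * pc) * (8 * d * ε / (1 - pc)) ^ 2 * (B / ε) := by
            gcongr
        _ = K * ε := by
            rw [hK]
            field_simp
            ring
    calc (bondPercolation (zdGraph d) p).real (clusterSizeGe (0 : Site d) n)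
        ≤ 2 * (bondPercolation (zdGraph d) p₁).real (clusterSizeGe (0 : Site d) n) +
            4 / β₁ * (β₂ - β₁) ^ 2 * (B / ε) := hH
      _ ≤ 2 * (B / (ε * n)) + K * ε := add_le_add (mul_le_mul_of_nonneg_left hM (by norm_num)) hquad
  -- the choice `ε = κ/√n`, `κ = ε₀/2`
  set κ : ℝ := ε₀ / 2 with hκ
  have hκ0 : 0 < κ := by positivity
  have hκε₀ : κ < ε₀ := by rw [hκ]; linarith
  refine ⟨2 * B / κ + K * κ, fun n hn => ?_⟩
  have hn0 : (0 : ℝ) < n := by exact_mod_cast hn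
  have hs0 : 0 < Real.sqrt n := Real.sqrt_pos.2 hn0
  have hs1 : 1 ≤ Real.sqrt n := by
    rw [show (1 : ℝ) = Real.sqrt 1 from Real.sqrt_one.symm]
    exact Real.sqrt_le_sqrt (by exact_mod_cast hn)
  have hs2 : Real.sqrt n ^ 2 = n := Real.sq_sqrt hn0.le
  have hε : 0 < κ / Real.sqrt n := by positivity
  have hεε₀ : κ / Real.sqrt n < ε₀ := lt_of_le_of_lt (div_le_self hκ0.le hs1) hκε₀
  have halg : ∀ s : ℝ, 0 < s →
      2 * (B / (κ / s * s ^ 2)) + K * (κ / s) = (2 * B / κ + K * κ) / s := by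
    intro s hs; field_simp
  calc (bondPercolation (zdGraph d) (criticalProbI d)).real (clusterSizeGe (0 : Site d) n)
      ≤ 2 * (B / (κ / Real.sqrt n * n)) + K * (κ / Real.sqrt n) := claim _ hε hεε₀ n hn
    _ = 2 * (B / (κ / Real.sqrt n * Real.sqrt n ^ 2)) + K * (κ / Real.sqrt n) := by rw [hs2]
    _ = (2 * B / κ + K * κ) / Real.sqrt n := halg _ hs0

end Literature.Probability.Percolation

end
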